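import Mathlib.Algebra.Group.Subgroup.Actions
import Mathlib.Algebra.Group.Action.Basic
import Mathlib.Algebra.GroupWithZero.Action.Pi
import Mathlib.Algebra.Group.Pi.Lemmas
import Mathlib.Algebra.Group.Hom.Basic
import Mathlib.Data.PNat.Basic
import Mathlib.Data.Nat.Factorial.Basic
import Mathlib.GroupTheory.GroupAction.Defs
import Mathlib.GroupTheory.Divisible

/-!
# Cyclotomes `Λ(A) = lim_n A[n]` and compatible systems of roots

Source: LANA Project interim report (July 2026) [LANA2026Report], §6.1 "Generalities on Kummer
maps", p. 31 (and §0.4 (f), p. 8, for the word "cyclotome"). For a commutative group `A`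
(written multiplicatively here; in the source `A = M^gp` is the groupification of a commutative
monoid `M` acted on by a group `G`) the report puts

  `Λ(M) := lim_{← n} M^gp[n]`,

the inverse limit, over the positive integers ordered by divisibility, of the `n`-torsion
subgroups, with transition maps `M^gp[nm] → M^gp[n]`, `x ↦ x^m`, "considered as a (topological)
`G`-module".

## What is here (real definitions, no named facts)

* `cyclotome A` : the inverse limit realised as the subgroup of the product `Π_{n : ℕ+} A` of
  families `ζ` with `ζ n ^ n = 1` and `ζ (n * m) ^ m = ζ n`; the `G`-action is componentwise
  (`MulDistribMulAction G (cyclotome A)`), and `cyclotome.map` is the functoriality in `A`.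
* `RootSystem a` : compatible systems of roots `x n` of an element `a` (`x 1 = a`,
  `x (n * m) ^ m = x n`, hence `x n ^ n = a`); two root systems of the same element differ by an
  element of the cyclotome (`RootSystem.divCyclotome`), a group element `g` transports root
  systems of `a` to root systems of `g • a`, and root systems exist as soon as `A` is divisible
  (`RootSystem.ofRootableBy`, over Mathlib's `RootableBy A ℕ` = hypothesis (a) of
  [LANA2026Report, §6.1 p.31]; the finiteness hypothesis (b) is not needed for existence in this
  discrete setting — it is what makes `Λ(M)` profinite, which we do not discuss).

These are the ingredients of the Kummer `1`-cocycle `h ↦ (h • x n / x n)_n` of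
`Literature/AnabelianGeometry/EtaleTheta/KummerClass.lean`.

## Conventions / not here

Groups are discrete (no topology); `ℕ+` indexes the limit; the `Ẑ^×`-action on `Λ` and the
profinite topology are not formalised here.
-/

namespace Literature.AnabelianGeometry.EtaleTheta

open Function

universe u

variable {A : Type u} [CommGroup A]

/-- The **cyclotome** `Λ(A) = lim_{← n} A[n]` of a commutative group `A`
[cite: LANA2026Report, §6.1 p.31]: the subgroup of `Π_{n : ℕ+} A` of families `ζ` such that
`ζ n` is `n`-torsion and `ζ (n * m) ^ m = ζ n` for all `n m : ℕ+` (the inverse limit of the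
torsion subgroups along the maps `x ↦ x ^ m`). -/
def cyclotome (A : Type u) [CommGroup A] : Subgroup (ℕ+ → A) where
  carrier := {ζ | (∀ n : ℕ+, ζ n ^ (n : ℕ) = 1) ∧ ∀ n m : ℕ+, ζ (n * m) ^ (m : ℕ) = ζ n}
  one_mem' := ⟨fun n => by simp, fun n m => by simp⟩
  mul_mem' := by
    rintro ζ ξ ⟨hζ₁, hζ₂⟩ ⟨hξ₁, hξ₂⟩
    exact ⟨fun n => by simp [Pi.mul_apply, mul_pow, hζ₁ n, hξ₁ n],
      fun n m => by simp [Pi.mul_apply, mul_pow, hζ₂ n m, hξ₂ n m]⟩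
  inv_mem' := by
    rintro ζ ⟨hζ₁, hζ₂⟩
    exact ⟨fun n => by simp [Pi.inv_apply, inv_pow, hζ₁ n],
      fun n m => by simp [Pi.inv_apply, inv_pow, hζ₂ n m]⟩

namespace cyclotome

/-- Membership in the cyclotome, unfolded. [cite: LANA2026Report, §6.1 p.31] -/
theorem mem_iff (ζ : ℕ+ → A) :
    ζ ∈ cyclotome A ↔ (∀ n : ℕ+, ζ n ^ (n : ℕ) = 1) ∧ ∀ n m : ℕ+, ζ (n * m) ^ (m : ℕ) = ζ n :=
  Iff.rfl

/-- Each component of an element of the cyclotome is torsion of the right order.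
[cite: LANA2026Report, §6.1 p.31] -/
theorem pow_eq_one (ζ : cyclotome A) (n : ℕ+) : (ζ : ℕ+ → A) n ^ (n : ℕ) = 1 := ζ.2.1 n

/-- The compatibility `ζ (n * m) ^ m = ζ n` of an element of the cyclotome.
[cite: LANA2026Report, §6.1 p.31] -/
theorem pow_apply_mul (ζ : cyclotome A) (n m : ℕ+) :
    (ζ : ℕ+ → A) (n * m) ^ (m : ℕ) = (ζ : ℕ+ → A) n := ζ.2.2 n m

/-- The first component of an element of the cyclotome is `1`.
[cite: LANA2026Report, §6.1 p.31] -/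
@[simp] theorem apply_one (ζ : cyclotome A) : (ζ : ℕ+ → A) 1 = 1 := by
  simpa using ζ.2.1 1

section Action

variable {G : Type*} [Group G] [MulDistribMulAction G A]

/-- The componentwise action of `G` on `Π_{n} A` preserves the cyclotome.
[cite: LANA2026Report, §6.1 p.31] -/
theorem smul_mem (g : G) {ζ : ℕ+ → A} (hζ : ζ ∈ cyclotome A) : g • ζ ∈ cyclotome A := by
  refine ⟨fun n => ?_, fun n m => ?_⟩
  · rw [Pi.smul_apply, ← smul_pow', hζ.1 n, smul_one]
  · rw [Pi.smul_apply, Pi.smul_apply, ← smul_pow', hζ.2 n m]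

/-- `G` acts on the cyclotome componentwise ("considered as a `G`-module",
[cite: LANA2026Report, §6.1 p.31]). -/
instance instSMul : SMul G (cyclotome A) := ⟨fun g ζ => ⟨g • (ζ : ℕ+ → A), smul_mem g ζ.2⟩⟩

/-- Components of the action. [cite: LANA2026Report, §6.1 p.31] -/
@[simp] theorem coe_smul (g : G) (ζ : cyclotome A) :
    ((g • ζ : cyclotome A) : ℕ+ → A) = g • (ζ : ℕ+ → A) := rfl

/-- Components of the action, pointwise. [cite: LANA2026Report, §6.1 p.31] -/
theorem smul_apply (g : G) (ζ : cyclotome A) (n : ℕ+) :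
    ((g • ζ : cyclotome A) : ℕ+ → A) n = g • (ζ : ℕ+ → A) n := rfl

/-- The cyclotome is a `G`-module: the componentwise action is by group automorphisms.
[cite: LANA2026Report, §6.1 p.31] -/
instance instMulDistribMulAction : MulDistribMulAction G (cyclotome A) where
  one_smul ζ := Subtype.ext (one_smul G (ζ : ℕ+ → A))
  mul_smul g h ζ := Subtype.ext (mul_smul g h (ζ : ℕ+ → A))
  smul_mul g ζ ξ := Subtype.ext (smul_mul' g (ζ : ℕ+ → A) (ξ : ℕ+ → A))
  smul_one g := Subtype.ext (by change g • (1 : ℕ+ → A) = 1; exact smul_one g)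

end Action

section Map

variable {B : Type*} [CommGroup B]

/-- Functoriality of the cyclotome: a group homomorphism `φ : A →* B` induces
`Λ(φ) : Λ(A) →* Λ(B)` componentwise (the map `λ` of [cite: LANA2026Report, §6.1 p.32]). -/
def map (φ : A →* B) : cyclotome A →* cyclotome B where
  toFun ζ := ⟨fun n => φ ((ζ : ℕ+ → A) n),
    ⟨fun n => by rw [← map_pow, ζ.2.1 n, map_one],
      fun n m => by rw [← map_pow, ζ.2.2 n m]⟩⟩
  map_one' := Subtype.ext (funext fun n => by simp)
  map_mul' ζ ξ := Subtype.ext (funext fun n => by simp)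

/-- Components of `Λ(φ)`. [cite: LANA2026Report, §6.1 p.32] -/
@[simp] theorem map_apply (φ : A →* B) (ζ : cyclotome A) (n : ℕ+) :
    ((map φ ζ : cyclotome B) : ℕ+ → B) n = φ ((ζ : ℕ+ → A) n) := rfl

end Map

end cyclotome

/-- A **compatible system of roots** of `a : A`: elements `x n` with `x 1 = a` and
`x (n * m) ^ m = x n` (so `x n ^ n = a`, `RootSystem.pow_self`). In [cite: LANA2026Report, §6.1
p.31] the Kummer map is built from the connecting maps of `0 → M^gp[n] → M^gp → M^gp → 0`,
i.e. from choices of `n`-th roots; "taking limits in `n`" amounts to choosing them compatibly. -/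
structure RootSystem (a : A) where
  /-- the chosen `n`-th root of `a`, for every `n : ℕ+` -/
  root : ℕ+ → A
  /-- the `1`-st root is `a` itself -/
  root_one : root 1 = a
  /-- compatibility: the `m`-th power of the chosen `nm`-th root is the chosen `n`-th root -/
  root_mul_pow : ∀ n m : ℕ+, root (n * m) ^ (m : ℕ) = root n

namespace RootSystem

variable {a b : A}

/-- Two root systems with the same roots are equal. [cite: LANA2026Report, §6.1 p.31] -/
@[ext] theorem ext {x y : RootSystem a} (h : x.root = y.root) : x = y := by
  cases x; cases y; congr

/-- `x n ^ n = a` for a compatible system of roots `x` of `a`.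
[cite: LANA2026Report, §6.1 p.31] -/
theorem pow_self (x : RootSystem a) (n : ℕ+) : x.root n ^ (n : ℕ) = a := by
  simpa [x.root_one] using x.root_mul_pow 1 n

/-- Transport of a root system along an equality of the element.
[cite: LANA2026Report, §6.1 p.31] -/
def cast (x : RootSystem a) (h : a = b) : RootSystem b :=
  ⟨x.root, x.root_one.trans h, x.root_mul_pow⟩

/-- `cast` does not change the roots. [cite: LANA2026Report, §6.1 p.31] -/
@[simp] theorem cast_root (x : RootSystem a) (h : a = b) : (x.cast h).root = x.root := rfl

/-- The trivial root system of `1`. [cite: LANA2026Report, §6.1 p.31] -/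
def one : RootSystem (1 : A) := ⟨1, rfl, fun n m => by simp⟩

/-- The product of root systems of `a` and `b` is a root system of `a * b`.
[cite: LANA2026Report, §6.1 p.31] -/
def mul (x : RootSystem a) (y : RootSystem b) : RootSystem (a * b) :=
  ⟨fun n => x.root n * y.root n, by rw [x.root_one, y.root_one],
    fun n m => by rw [mul_pow, x.root_mul_pow, y.root_mul_pow]⟩

/-- Roots of the product system. [cite: LANA2026Report, §6.1 p.31] -/
@[simp] theorem mul_root (x : RootSystem a) (y : RootSystem b) (n : ℕ+) :
    (x.mul y).root n = x.root n * y.root n := rfl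

/-- The inverse of a root system of `a` is a root system of `a⁻¹`.
[cite: LANA2026Report, §6.1 p.31] -/
def inv (x : RootSystem a) : RootSystem a⁻¹ :=
  ⟨fun n => (x.root n)⁻¹, by rw [x.root_one], fun n m => by rw [inv_pow, x.root_mul_pow]⟩

/-- Roots of the inverse system. [cite: LANA2026Report, §6.1 p.31] -/
@[simp] theorem inv_root (x : RootSystem a) (n : ℕ+) : x.inv.root n = (x.root n)⁻¹ := rfl

/-- Two compatible systems of roots of the same element differ by an element of the cyclotome:
`n ↦ y n / x n` lies in `Λ(A)`. [cite: LANA2026Report, §6.1 p.31] -/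
def divCyclotome (x y : RootSystem a) : cyclotome A :=
  ⟨fun n => y.root n / x.root n,
    ⟨fun n => by rw [div_pow, x.pow_self, y.pow_self, div_self'],
      fun n m => by rw [div_pow, x.root_mul_pow, y.root_mul_pow]⟩⟩

/-- Components of `divCyclotome`. [cite: LANA2026Report, §6.1 p.31] -/
@[simp] theorem divCyclotome_apply (x y : RootSystem a) (n : ℕ+) :
    ((divCyclotome x y : cyclotome A) : ℕ+ → A) n = y.root n / x.root n := rfl

/-- Conversely, multiplying a root system of `a` by an element of the cyclotome gives a root
system of `a`. [cite: LANA2026Report, §6.1 p.31] -/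
def mulCyclotome (x : RootSystem a) (ζ : cyclotome A) : RootSystem a :=
  ⟨fun n => x.root n * (ζ : ℕ+ → A) n, by rw [cyclotome.apply_one, mul_one, x.root_one],
    fun n m => by rw [mul_pow, x.root_mul_pow, cyclotome.pow_apply_mul]⟩

/-- Roots of `mulCyclotome`. [cite: LANA2026Report, §6.1 p.31] -/
@[simp] theorem mulCyclotome_root (x : RootSystem a) (ζ : cyclotome A) (n : ℕ+) :
    (x.mulCyclotome ζ).root n = x.root n * (ζ : ℕ+ → A) n := rfl

/-- `x · (y / x) = y`. [cite: LANA2026Report, §6.1 p.31] -/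
@[simp] theorem mulCyclotome_divCyclotome (x y : RootSystem a) :
    x.mulCyclotome (divCyclotome x y) = y :=
  ext (funext fun n => by simp [mul_div_cancel])

section Action

variable {G : Type*} [Group G] [MulDistribMulAction G A]

/-- A group element transports a root system of `a` to a root system of `g • a`
(componentwise action). [cite: LANA2026Report, §6.1 p.31] -/
def smul (g : G) (x : RootSystem a) : RootSystem (g • a) :=
  ⟨fun n => g • x.root n, by rw [x.root_one],
    fun n m => by rw [← smul_pow', x.root_mul_pow]⟩

/-- Roots of the transported system. [cite: LANA2026Report, §6.1 p.31] -/
@[simp] theorem smul_root (g : G) (x : RootSystem a) (n : ℕ+) :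
    (x.smul g).root n = g • x.root n := rfl

end Action

section Map

variable {B : Type*} [CommGroup B]

/-- A group homomorphism `φ` sends a root system of `a` to a root system of `φ a` (used for the
functoriality of Kummer maps, [cite: LANA2026Report, §6.1 p.32]). -/
def map (φ : A →* B) (x : RootSystem a) : RootSystem (φ a) :=
  ⟨fun n => φ (x.root n), by rw [x.root_one], fun n m => by rw [← map_pow, x.root_mul_pow]⟩

/-- Roots of the image system. [cite: LANA2026Report, §6.1 p.32] -/
@[simp] theorem map_root (φ : A →* B) (x : RootSystem a) (n : ℕ+) :
    (x.map φ).root n = φ (x.root n) := rfl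

end Map

section Existence

variable [RootableBy A ℕ]

/-- A chain of roots along the factorials: `c 0 = a` and `c (k+1) ^ (k+1) = c k`, read off
from the `RootableBy A ℕ` structure (hypothesis (a) of [LANA2026Report, §6.1 p.31]). [folklore] -/
private def chain (a : A) : ℕ → A
  | 0 => a
  | k + 1 => RootableBy.root (chain a k) (k + 1)

/-- `c 0 = a`. [folklore] -/
private theorem chain_zero (a : A) : chain a 0 = a := rfl

/-- `c (k+1) ^ (k+1) = c k`. [folklore] -/
private theorem chain_succ_pow (a : A) (k : ℕ) : chain a (k + 1) ^ (k + 1) = chain a k :=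
  RootableBy.root_cancel _ (Nat.succ_ne_zero k)

/-- `c l ^ (l! / k!) = c k` for `k ≤ l`. [folklore] -/
private theorem chain_pow_div_factorial (a : A) {k l : ℕ} (hkl : k ≤ l) :
    chain a l ^ (l.factorial / k.factorial) = chain a k := by
  induction l, hkl using Nat.le_induction with
  | base => rw [Nat.div_self (Nat.factorial_pos k), pow_one]
  | succ l hkl ih =>
    rw [Nat.factorial_succ, Nat.mul_div_assoc _ (Nat.factorial_dvd_factorial hkl), pow_mul,
      chain_succ_pow, ih]

/-- The exponent bookkeeping `(nm)!/(nm) · m = ((nm)!/n!) · (n!/n)` (both sides are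
`(nm)!/n`). [folklore] -/
private theorem factorial_exponent_identity {n m : ℕ} (hn : 0 < n) (hm : 0 < m) :
    (n * m).factorial / (n * m) * m = (n * m).factorial / n.factorial * (n.factorial / n) := by
  have h1 : n.factorial ∣ (n * m).factorial :=
    Nat.factorial_dvd_factorial (Nat.le_mul_of_pos_right _ hm)
  have h2 : n ∣ n.factorial := Nat.dvd_factorial hn le_rfl
  have h3 : n * m ∣ (n * m).factorial := Nat.dvd_factorial (Nat.mul_pos hn hm) le_rfl
  rw [← Nat.div_div_eq_div_mul, Nat.div_mul_cancel (Nat.dvd_div_of_mul_dvd h3),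
    ← Nat.mul_div_assoc _ h2, Nat.div_mul_cancel h1]

/-- In a rootable (= divisible) commutative group every element admits a compatible system of
roots: take roots along the cofinal chain `1 ∣ 2! ∣ 3! ∣ ⋯` and put `x n := c n ^ (n! / n)`.
This is the existence part of "taking limits in `n`" in [cite: LANA2026Report, §6.1 p.31]
(their hypothesis (a), `n`-divisibility; hypothesis (b), finiteness of the torsion, is not
needed for it). -/
def ofRootableBy (a : A) : RootSystem a where
  root n := chain a n ^ ((n : ℕ).factorial / (n : ℕ))
  root_one := by
    have h1 := chain_succ_pow a 0
    simp only [zero_add, pow_one] at h1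
    simpa [chain_zero] using h1
  root_mul_pow n m := by
    have hn : (n : ℕ) ≤ (n : ℕ) * m := Nat.le_mul_of_pos_right _ m.pos
    simp only [PNat.mul_coe]
    rw [← chain_pow_div_factorial a hn, ← pow_mul, ← pow_mul]
    congr 1
    exact factorial_exponent_identity n.pos m.pos

/-- Hence root systems exist in rootable groups. [cite: LANA2026Report, §6.1 p.31] -/
instance instNonempty (a : A) : Nonempty (RootSystem a) := ⟨ofRootableBy a⟩

end Existence

end RootSystem

end Literature.AnabelianGeometry.EtaleTheta
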